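import Summits.QuantumFields.YangMills.Theorems.ContinuumLimitExists.Negative.FrozenMoments
import Summits.QuantumFields.YangMills.Theorems.ParabolicTrajectoryContinuumLimitOnTrajectoryStubOSLegsA_Lattice
import Summits.QuantumFields.YangMills.Theorems.ParabolicTrajectoryContinuumLimitOnTrajectoryDefsE
import Summits.QuantumFields.YangMills.Theorems.ParabolicTrajectoryContinuumLimitOnTrajectoryUclDefs

/-!
# `ContinuumLimitExists` — negative side II: the over-cooled CANONICAL scheme
# (every conjunct of the line's `∃`-stub except non-degeneracy is witnessed by a frozen scheme)

Tightness certificate for crux `stmt-QuantumFields-16124`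
(`Summit.QuantumFields.YangMills.Theses.OneCertifiedCube.ContinuumLimitExists`), line `birth`
(`Cruxes/ContinuumLimitExists/Lines/birth.lean`, skeleton v3), lead prover
`prover-line-stmt-QuantumFields-16124-0`, cycle 2 (2026-08-17).

The registered `∃`-stub of the line is
`stub_uvScheme : ∃ r sch, sch.HasWeakCouplingLimit ∧ PolyVolumeGrowth sch ∧ ConvProducts r sch ∧ UUVB r sch ∧
ND2 r sch ∧ ND3 r sch`, and the two `∀`-stubs conclude `Rot345 r sch`, `CoreClustering r sch` from the
first four conjuncts. This file exhibits, for EVERY compact `G` with a faithful unitary lattice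
representation `r`, the **over-cooled canonical scheme** `overcooled r` — `a_k = 1/(k+1)`,
`L_k = (k+1)²`, and `β_k ≥ k` a freezing threshold of the torus of side `2L_k+1` chosen (diagonally, from
part I `FrozenMoments.eventually_abs_centredMoment_le`) so that EVERY centred plaquette-string moment of
length `1 ≤ p ≤ k` on that torus is at most `ε_k = ((k+1)·((2L_k+1)⁴)^k)⁻¹` — and proves:

* `hasWeakCouplingLimit_overcooled`, `polyVolumeGrowth_overcooled` (`N = 1`);
* `norm_canonDistribution_overcooled_le`: for `1 ≤ p ≤ k`, every canonical lattice distribution of a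
  string over the alphabet {plaquettes, action density} is bounded by `|F|₀ /(k+1)` (sup norm of the
  test function; NO off-diagonality, NO smoothness used) — hence every canonical curvature `p`-point
  function tends to `0` (`tendsto_curvDistribution_overcooled`);
* consequently `convProducts_overcooled` (all limits exist, `= 0`), `rot345_overcooled`,
  `coreClustering_overcooled` (both `∀`-stub CONCLUSIONS hold, trivially), while
  `not_ND2_overcooled`, `not_ND3_overcooled`: the non-degeneracy clauses FAIL.

Reading for the planners (with `NoGaussianWitness.md` of the crux directory): along `β_k → ∞` the only
rigorously accessible regimes are frozen — canonical normalisation ⇒ all limits `0` (this file: fails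
`ND2`/`ND3`); `β`-rescaled normalisation ⇒ free-gluon Wick square (fails `IsNonGaussian` by duality).
ALL existence content of `stub_uvScheme` therefore sits in `ND2 ∧ ND3` JOINTLY WITH convergence, i.e. in
probing the theory at the confinement scale; `ConvProducts`, `UUVB` (part III), `Rot345`,
`CoreClustering`, `PolyVolumeGrowth`, `HasWeakCouplingLimit` carry none by themselves.
No `sorry`; axioms `propext`, `Classical.choice`, `Quot.sound`.
-/

noncomputable section

open scoped SchwartzMap
open Filter Topology MeasureTheory Finset
open Literature.MathematicalPhysics.QuantumFieldTheory Literature.MathematicalPhysics.QuantumLattice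
open Literature.MathematicalPhysics.AQFT Literature.Probability.LatticeModels
open Summit.QuantumFields.YangMills.Cruxes.ContinuumLimitOnTrajectory.TwoOrbitSynchronisation
open Summit.QuantumFields.YangMills.Theorems.TunedSequenceExists.Negative.Freezing

namespace Summit.QuantumFields.YangMills.Theorems.ContinuumLimitExists.Negative

local notation "𝔼" => EuclideanSpace ℝ (Fin 4)

variable {G : Type} [Group G] [TopologicalSpace G] [IsTopologicalGroup G] [CompactSpace G]
  [MeasurableSpace G] [BorelSpace G]

/-! ## §1 Canonical distributions of alphabet strings are finite sums of centred moments -/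

/-- **Lattice-sum form.** The canonical lattice distribution of a string over the alphabet is the
finite sum, over positions in `box 4 L_k`, of the test function at the scaled positions times the
centred moment of part I. -/
theorem canonDistribution_obsOf_eq_sum (r : LatticeRep G) (sch : SpeciesScheme (YMSpecies G)) (k p : ℕ)
    (τ : Fin p → Option PlaqIdx) (F : 𝓢((Fin p → 𝔼), ℂ)) :
    canonDistribution r sch k p (fun i => obsOf r (τ i)) F =
      ∑ x : Fin p → ↥(box 4 (sch.L k)), F (fun i => sch.a k • siteToE (↑(x i) : Site 4)) *
        ((centredMoment r (sch.L k) (sch.β k) p τ (fun i => (x i : Site 4)) : ℝ) : ℂ) := by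
  haveI : SecondCountableTopology G := secondCountable_of_latticeRep r
  haveI : IsProbabilityMeasure (wilsonMeasure (d := 4) (L := sch.side k) (G := G) r.ρ (sch.β k)) :=
    isProbabilityMeasure_wilsonMeasure r.ρ r.continuous _
  have hcont : ∀ x : Fin p → ↥(box 4 (sch.L k)), Continuous fun U : GaugeConfig 4 (sch.side k) G =>
      ∏ i, ((obsOf r (τ i)).F (configShift (-(↑(x i) : Site 4)) (torusLift (sch.side k) U)) -
        wilsonTorusMean r.ρ (sch.β k) (sch.L k) (obsOf r (τ i)).F) := fun x =>
    continuous_finsetProd _ fun i _ =>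
      (continuous_obsOf_shift_lift r (τ i) _ _).sub continuous_const
  unfold canonDistribution
  simp only [← Complex.ofReal_prod]
  rw [integral_finsetSum _ fun x _ => ((integrable_of_continuous _ (hcont x)).ofReal).const_mul _]
  refine Finset.sum_congr rfl fun x _ => ?_
  rw [integral_const_mul, integral_complex_ofReal]
  rfl

/-- **Sup-norm bound.** If every centred moment of the string at positions in the box is at most `ε`,
the canonical distribution is at most `((2L_k+1)⁴)^p · |F|₀ · ε` (only the sup norm `schwartzNorm 0` of
the test function enters). -/
theorem norm_canonDistribution_obsOf_le (r : LatticeRep G) (sch : SpeciesScheme (YMSpecies G)) (k p : ℕ)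
    (τ : Fin p → Option PlaqIdx) (F : 𝓢((Fin p → 𝔼), ℂ)) {ε : ℝ}
    (h : ∀ x : Fin p → ↥(box 4 (sch.L k)), |centredMoment r (sch.L k) (sch.β k) p τ (fun i => (x i : Site 4))| ≤ ε) :
    ‖canonDistribution r sch k p (fun i => obsOf r (τ i)) F‖ ≤
      ((2 * (sch.L k : ℝ) + 1) ^ 4) ^ p * schwartzNorm 0 F * ε := by
  rw [canonDistribution_obsOf_eq_sum]
  refine (norm_sum_le _ _).trans ?_
  have hterm : ∀ x ∈ (Finset.univ : Finset (Fin p → ↥(box 4 (sch.L k)))),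
      ‖F (fun i => sch.a k • siteToE (↑(x i) : Site 4)) *
        ((centredMoment r (sch.L k) (sch.β k) p τ (fun i => (x i : Site 4)) : ℝ) : ℂ)‖ ≤
          schwartzNorm 0 F * ε := fun x _ => by
    rw [norm_mul, Complex.norm_real, Real.norm_eq_abs]
    exact mul_le_mul (norm_le_schwartzNorm 0 F _) (h x) (abs_nonneg _) (schwartzNorm_nonneg _ _)
  refine (Finset.sum_le_sum hterm).trans ?_
  rw [Finset.sum_const, nsmul_eq_mul, Finset.card_univ, Fintype.card_pi, Finset.prod_const,
    Finset.card_univ, Fintype.card_fin, Fintype.card_coe, card_box]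
  push_cast
  ring_nf
  rfl

/-! ## §2 The over-cooled canonical scheme -/

/-- Torus half-side `L_k = (k+1)²`. -/
def ocL (k : ℕ) : ℕ := (k + 1) ^ 2

/-- The level-`k` smallness target `ε_k = ((k+1)·((2L_k+1)⁴)^k)⁻¹`. -/
def epsK (k : ℕ) : ℝ := ((k + 1 : ℝ) * (((2 * (ocL k : ℝ) + 1) ^ 4) ^ k))⁻¹

/-- `ε_k > 0`. -/
theorem epsK_pos (k : ℕ) : 0 < epsK k := by
  have h1 : (0 : ℝ) < (k + 1 : ℝ) := by positivity
  have h2 : (0 : ℝ) < ((2 * (ocL k : ℝ) + 1) ^ 4) ^ k := by positivity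
  exact inv_pos.2 (mul_pos h1 h2)

/-- A freezing threshold at level `k`: beyond it, every centred moment of length `1 ≤ p ≤ k` over the
alphabet on the torus of half-side `L_k` is at most `ε_k`. -/
theorem exists_threshold (r : LatticeRep G) (k : ℕ) : ∃ T : ℝ, ∀ β : ℝ, T ≤ β →
    ∀ p : ℕ, p ≤ k → 1 ≤ p → ∀ (τ : Fin p → Option PlaqIdx) (x : Fin p → ↥(box 4 (ocL k))),
      |centredMoment r (ocL k) β p τ (fun i => (x i : Site 4))| ≤ epsK k :=
  Filter.eventually_atTop.1 (eventually_abs_centredMoment_le r (ocL k) k (epsK_pos k))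

/-- The over-cooled coupling `β_k = max(k, T_k)`: at least `k` and beyond the level-`k` threshold. -/
def ocBeta (r : LatticeRep G) (k : ℕ) : ℝ := max (k : ℝ) (Classical.choose (exists_threshold r k))

/-- `k ≤ β_k`. -/
theorem le_ocBeta (r : LatticeRep G) (k : ℕ) : (k : ℝ) ≤ ocBeta r k := le_max_left _ _

/-- `β_k` is beyond the level-`k` freezing threshold: every centred moment of length `1 ≤ p ≤ k` is at
most `ε_k`. -/
theorem ocBeta_spec (r : LatticeRep G) {k p : ℕ} (hpk : p ≤ k) (hp : 1 ≤ p) (τ : Fin p → Option PlaqIdx)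
    (x : Fin p → ↥(box 4 (ocL k))) :
    |centredMoment r (ocL k) (ocBeta r k) p τ (fun i => (x i : Site 4))| ≤ epsK k :=
  Classical.choose_spec (exists_threshold r k) _ (le_max_right _ _) p hpk hp τ x

/-- **The over-cooled canonical scheme** of `r`: `a_k = 1/(k+1)`, `L_k = (k+1)²`, `β_k = ocBeta r k`
(`c`, `m` are unused by the canonical vocabulary and set to `0`). -/
def overcooled (r : LatticeRep G) : SpeciesScheme (YMSpecies G) where
  a := fun k => ((k : ℝ) + 1)⁻¹
  a_pos := fun k => by positivity
  tendsto_a := tendsto_inv_atTop_zero.comp (tendsto_natCast_atTop_atTop.atTop_add tendsto_const_nhds)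
  β := ocBeta r
  L := ocL
  tendsto_L := by
    have h : (fun k : ℕ => ((k : ℝ) + 1)⁻¹ * ((ocL k : ℕ) : ℝ)) = fun k : ℕ => (k : ℝ) + 1 := by
      funext k; unfold ocL; push_cast; field_simp
    rw [h]
    exact tendsto_natCast_atTop_atTop.atTop_add tendsto_const_nhds
  c := fun _ _ => 0
  m := fun _ _ => 0

/-- The torus half-side of the over-cooled scheme. -/
@[simp] theorem overcooled_L (r : LatticeRep G) (k : ℕ) : (overcooled r).L k = ocL k := rfl

/-- The coupling of the over-cooled scheme. -/
@[simp] theorem overcooled_β (r : LatticeRep G) (k : ℕ) : (overcooled r).β k = ocBeta r k := rfl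

/-- The spacing of the over-cooled scheme. -/
@[simp] theorem overcooled_a (r : LatticeRep G) (k : ℕ) : (overcooled r).a k = ((k : ℝ) + 1)⁻¹ := rfl

/-- **Weak coupling**: `β_k ≥ k → ∞`. -/
theorem hasWeakCouplingLimit_overcooled (r : LatticeRep G) : (overcooled r).HasWeakCouplingLimit :=
  tendsto_atTop_mono (le_ocBeta r) tendsto_natCast_atTop_atTop

/-- **Polynomial volume growth** with exponent `N = 1`: `a_k⁻¹ = k+1 = a_k L_k`. -/
theorem polyVolumeGrowth_overcooled (r : LatticeRep G) : PolyVolumeGrowth (overcooled r) := by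
  refine ⟨1, le_rfl, Eventually.of_forall fun k => ?_⟩
  simp only [overcooled_a, overcooled_L, ocL, inv_inv, pow_one]
  push_cast
  have hk : (0 : ℝ) < (k : ℝ) + 1 := by positivity
  rw [← div_eq_inv_mul, le_div_iff₀ hk]
  nlinarith

/-! ## §3 Every canonical distribution of the over-cooled scheme is small -/

/-- **Smallness**: for `1 ≤ p ≤ k`, every canonical lattice distribution of an alphabet string at level
`k` of the over-cooled scheme is at most `|F|₀/(k+1)`. -/
theorem norm_canonDistribution_overcooled_le (r : LatticeRep G) {k p : ℕ} (hp : 1 ≤ p) (hpk : p ≤ k)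
    (τ : Fin p → Option PlaqIdx) (F : 𝓢((Fin p → 𝔼), ℂ)) :
    ‖canonDistribution r (overcooled r) k p (fun i => obsOf r (τ i)) F‖ ≤ schwartzNorm 0 F / (k + 1) := by
  have h := norm_canonDistribution_obsOf_le r (overcooled r) k p τ F
    (fun x => ocBeta_spec r hpk hp τ x)
  refine h.trans ?_
  simp only [overcooled_L]
  have hs : (1 : ℝ) ≤ (2 * (ocL k : ℝ) + 1) ^ 4 :=
    one_le_pow₀ (by have h0 : (0 : ℝ) ≤ 2 * (ocL k : ℝ) := by positivity
                    linarith)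
  have hpow : ((2 * (ocL k : ℝ) + 1) ^ 4) ^ p ≤ ((2 * (ocL k : ℝ) + 1) ^ 4) ^ k :=
    pow_le_pow_right₀ hs hpk
  have hk : (0 : ℝ) < (k : ℝ) + 1 := by positivity
  have hS : (0 : ℝ) < ((2 * (ocL k : ℝ) + 1) ^ 4) ^ k := by positivity
  have hN := schwartzNorm_nonneg 0 F
  unfold epsK
  rw [div_eq_mul_inv, mul_inv]
  calc ((2 * (ocL k : ℝ) + 1) ^ 4) ^ p * schwartzNorm 0 F * (((k : ℝ) + 1)⁻¹ * (((2 * (ocL k : ℝ) + 1) ^ 4) ^ k)⁻¹)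
      = (((2 * (ocL k : ℝ) + 1) ^ 4) ^ p * (((2 * (ocL k : ℝ) + 1) ^ 4) ^ k)⁻¹) *
          (schwartzNorm 0 F * ((k : ℝ) + 1)⁻¹) := by ring
    _ ≤ 1 * (schwartzNorm 0 F * ((k : ℝ) + 1)⁻¹) := by
        refine mul_le_mul_of_nonneg_right ?_ (by positivity)
        rw [mul_inv_le_iff₀ hS, one_mul]
        exact hpow
    _ = schwartzNorm 0 F * ((k : ℝ) + 1)⁻¹ := one_mul _

/-- The curvature string: every canonical curvature `p`-point distribution (`1 ≤ p ≤ k`) is at most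
`|F|₀/(k+1)`. -/
theorem norm_curvDistribution_overcooled_le (r : LatticeRep G) {k p : ℕ} (hp : 1 ≤ p) (hpk : p ≤ k)
    (F : 𝓢((Fin p → 𝔼), ℂ)) :
    ‖curvDistribution r (overcooled r) k p F‖ ≤ schwartzNorm 0 F / (k + 1) := by
  rw [← canonDistribution_curvature]
  exact norm_canonDistribution_overcooled_le r hp hpk (fun _ => none) F

/-- A `k`-uniform bound including arity `0`: for `p ≤ k`, `‖curvDistribution‖ ≤ |F|₀`. -/
theorem norm_curvDistribution_overcooled_le' (r : LatticeRep G) {k p : ℕ} (hpk : p ≤ k)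
    (F : 𝓢((Fin p → 𝔼), ℂ)) :
    ‖curvDistribution r (overcooled r) k p F‖ ≤ schwartzNorm 0 F := by
  rcases Nat.eq_zero_or_pos p with rfl | hp
  · rw [curvDistribution_zero]; exact norm_le_schwartzNorm 0 F _
  · refine (norm_curvDistribution_overcooled_le r hp hpk F).trans ?_
    have hk : (1 : ℝ) ≤ (k : ℝ) + 1 := by
      have : (0 : ℝ) ≤ k := Nat.cast_nonneg k
      linarith
    exact div_le_self (schwartzNorm_nonneg 0 F) hk

/-- **All canonical curvature functions of the over-cooled scheme tend to `0`** (`p ≥ 1`). -/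
theorem tendsto_curvDistribution_overcooled (r : LatticeRep G) {p : ℕ} (hp : 1 ≤ p)
    (F : 𝓢((Fin p → 𝔼), ℂ)) :
    Tendsto (fun k => curvDistribution r (overcooled r) k p F) atTop (𝓝 0) := by
  have hlim : Tendsto (fun k : ℕ => schwartzNorm 0 F / ((k : ℝ) + 1)) atTop (𝓝 0) :=
    tendsto_const_nhds.div_atTop (tendsto_natCast_atTop_atTop.atTop_add tendsto_const_nhds)
  refine squeeze_zero_norm' ?_ hlim
  filter_upwards [eventually_ge_atTop p] with k hk
  exact norm_curvDistribution_overcooled_le r hp hk F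

/-! ## §4 What the over-cooled scheme satisfies and what it violates -/

/-- **`ConvProducts` holds**: every canonical curvature `p`-point function on a real product tensor
converges — to `0`. -/
theorem convProducts_overcooled (r : LatticeRep G) : ConvProducts r (overcooled r) := by
  intro p hp f _
  refine ⟨0, ?_⟩
  have ht := tendsto_curvDistribution_overcooled r (Nat.one_le_iff_ne_zero.2 hp)
    (SchwartzMap.tensorFin p fun i => ofRealTest (f i))
  have hre := (Complex.continuous_re.tendsto 0).comp ht
  refine hre.congr fun k => ?_
  simp only [Function.comp_apply,
    curvDistribution_tensor r (overcooled r) k p (isTensorOf_tensorFin fun i => ofRealTest (f i)),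
    Complex.ofReal_re]

/-- **`ND2` fails**: no time-ordered pair has a canonical two-point distribution bounded away from `0`. -/
theorem not_ND2_overcooled (r : LatticeRep G) : ¬ ND2 r (overcooled r) := by
  rintro ⟨F, G₁, H, -, -, -, δ, hδ, hev⟩
  have ht := tendsto_curvDistribution_overcooled r (p := 1 + 1) (by norm_num) H
  have hsmall : ∀ᶠ k in atTop, ‖curvDistribution r (overcooled r) k (1 + 1) H‖ < δ := by
    filter_upwards [(Metric.tendsto_nhds.1 ht) δ hδ] with k hk
    simpa [dist_zero_right] using hk
  obtain ⟨k, h1, h2⟩ := (hev.and hsmall).exists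
  exact absurd h1 (not_le.2 h2)

/-- **`ND3` fails**: no off-diagonal triple has a canonical three-point distribution bounded away
from `0`. -/
theorem not_ND3_overcooled (r : LatticeRep G) : ¬ ND3 r (overcooled r) := by
  rintro ⟨f, g, h, F₃, -, -, δ, hδ, hev⟩
  have ht := tendsto_curvDistribution_overcooled r (p := 3) (by norm_num) F₃
  have hsmall : ∀ᶠ k in atTop, ‖curvDistribution r (overcooled r) k 3 F₃‖ < δ := by
    filter_upwards [(Metric.tendsto_nhds.1 ht) δ hδ] with k hk
    simpa [dist_zero_right] using hk
  obtain ⟨k, h1, h2⟩ := (hev.and hsmall).exists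
  exact absurd h1 (not_le.2 h2)

/-- **`Rot345` holds (trivially)**: rotating the test function changes the canonical curvature
distributions by `o(1)` — both tend to `0`. -/
theorem rot345_overcooled (r : LatticeRep G) : Rot345 r (overcooled r) := by
  intro R _ _ _ _ p F _
  rcases Nat.eq_zero_or_pos p with rfl | hp
  · have h0 : ∀ k, curvDistribution r (overcooled r) k 0 (linActMulti R F) -
        curvDistribution r (overcooled r) k 0 F = 0 := fun k => by
      rw [curvDistribution_zero, curvDistribution_zero, linActMulti_apply, sub_eq_zero]
      exact congrArg F (Subsingleton.elim _ _)
    simp only [h0]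
    exact tendsto_const_nhds
  · have h := (tendsto_curvDistribution_overcooled r hp (linActMulti R F)).sub
      (tendsto_curvDistribution_overcooled r hp F)
    rwa [sub_zero] at h

/-- Products with one vanishing factor: if `‖u_k‖ ≤ M` eventually and `v_k → 0` then `u_k v_k → 0` and
`v_k u_k → 0` (complex sequences). -/
theorem tendsto_mul_zero_of_bounded {u v : ℕ → ℂ} {M : ℝ} (hu : ∀ᶠ k in atTop, ‖u k‖ ≤ M)
    (hv : Tendsto v atTop (𝓝 0)) : Tendsto (fun k => u k * v k) atTop (𝓝 0) := by
  have hM : Tendsto (fun k => M * ‖v k‖) atTop (𝓝 0) := by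
    simpa using (tendsto_norm_zero.comp hv).const_mul M
  refine squeeze_zero_norm' ?_ hM
  filter_upwards [hu] with k hk
  rw [norm_mul]
  exact mul_le_mul_of_nonneg_right hk (norm_nonneg _)

/-- **`CoreClustering` holds (trivially)**: every clustering defect tends to `0` because every
positive-arity canonical distribution does, and the arity-`0` ones are evaluations. -/
theorem coreClustering_overcooled (r : LatticeRep G) : CoreClustering r (overcooled r) := by
  intro n₁ n₂ Low Up _ _ crd _ P _ _ b _ _ ε hε
  refine ⟨0, fun t _ => ?_⟩
  set X := translateMulti (t • b) Up with hX
  -- the clustering defect tends to `0` along `k`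
  have hdef : Tendsto (fun k => curvDistribution r (overcooled r) k (n₁ + n₂) (Low.appendTensor X) -
      curvDistribution r (overcooled r) k n₁ Low * curvDistribution r (overcooled r) k n₂ X)
      atTop (𝓝 0) := by
    rcases Nat.eq_zero_or_pos n₁ with rfl | h₁
    · rcases Nat.eq_zero_or_pos n₂ with rfl | h₂
      · -- both arities `0`: the defect is identically `0`
        have h0 : ∀ k, curvDistribution r (overcooled r) k (0 + 0) (Low.appendTensor X) -
            curvDistribution r (overcooled r) k 0 Low * curvDistribution r (overcooled r) k 0 X = 0 := by
          intro k
          have e : curvDistribution r (overcooled r) k (0 + 0) (Low.appendTensor X) =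
              (Low.appendTensor X) default := curvDistribution_zero r (overcooled r) k _
          rw [e, curvDistribution_zero, curvDistribution_zero, SchwartzMap.appendTensor_apply, sub_eq_zero]
          exact congrArg₂ (· * ·) (congrArg Low (Subsingleton.elim _ _)) (congrArg X (Subsingleton.elim _ _))
        simp only [h0]
        exact tendsto_const_nhds
      · -- `n₁ = 0 < n₂`
        have hA := tendsto_curvDistribution_overcooled r (p := 0 + n₂) (by omega) (Low.appendTensor X)
        have hB : Tendsto (fun k => curvDistribution r (overcooled r) k 0 Low *
            curvDistribution r (overcooled r) k n₂ X) atTop (𝓝 0) :=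
          tendsto_mul_zero_of_bounded (M := schwartzNorm 0 Low)
            (Eventually.of_forall fun k => norm_curvDistribution_overcooled_le' r (Nat.zero_le k) Low)
            (tendsto_curvDistribution_overcooled r h₂ X)
        simpa using hA.sub hB
    · have hA := tendsto_curvDistribution_overcooled r (p := n₁ + n₂) (by omega) (Low.appendTensor X)
      have hB : Tendsto (fun k => curvDistribution r (overcooled r) k n₁ Low *
          curvDistribution r (overcooled r) k n₂ X) atTop (𝓝 0) := by
        have h := tendsto_mul_zero_of_bounded (M := schwartzNorm 0 X)
          (u := fun k => curvDistribution r (overcooled r) k n₂ X)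
          (v := fun k => curvDistribution r (overcooled r) k n₁ Low) ?_
          (tendsto_curvDistribution_overcooled r h₁ Low)
        · simpa [mul_comm] using h
        · filter_upwards [eventually_ge_atTop n₂] with k hk
          exact norm_curvDistribution_overcooled_le' r hk X
      simpa using hA.sub hB
  filter_upwards [(Metric.tendsto_nhds.1 hdef) ε hε] with k hk
  rw [dist_zero_right] at hk
  exact hk.le

/-- **Summary (tightness of the `∃`-stub of line `birth`).** For every compact `G` admitting a faithful
unitary lattice representation, some scheme satisfies `HasWeakCouplingLimit ∧ PolyVolumeGrowth ∧
ConvProducts ∧ Rot345 ∧ CoreClustering` and violates `ND2` and `ND3`: the non-degeneracy clauses are the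
load-bearing conjuncts of `stub_uvScheme`, and the conclusions of both `∀`-stubs are consistent with
(indeed implied by) total degeneration. -/
theorem exists_degenerate_scheme (r : LatticeRep G) :
    ∃ sch : SpeciesScheme (YMSpecies G), sch.HasWeakCouplingLimit ∧ PolyVolumeGrowth sch ∧
      ConvProducts r sch ∧ Rot345 r sch ∧ CoreClustering r sch ∧ ¬ ND2 r sch ∧ ¬ ND3 r sch :=
  ⟨overcooled r, hasWeakCouplingLimit_overcooled r, polyVolumeGrowth_overcooled r, convProducts_overcooled r,
    rot345_overcooled r, coreClustering_overcooled r, not_ND2_overcooled r, not_ND3_overcooled r⟩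

end Summit.QuantumFields.YangMills.Theorems.ContinuumLimitExists.Negative

end
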